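import Literature.Probability.RandomPlanarGeometry.LoewnerDescriptionProofs
import Literature.Probability.RandomPlanarGeometry.SLEStoppedCurveEvents
import HarnessLib

/-!
# Stub `stub_arcClock` of line `capacity-clock-no-plateau`: the arc clock

Crux `SimpleSubseqLimits` (stmt-CriticalPhenomena-4982, decl
`Summit.CriticalPhenomena.SAWScalingLimit.Theses.SAWLoopFugacityFlow.SimpleSubseqLimits`).

THE LEVER of the line (deterministic): a curve class `c` described by the Loewner evolution
through a chordal uniformizing map `φ` of the Dobrushin domain `(D; a, b)`
(`IsLoewnerDescribable φ c`: `c = mk κ`, `κ` the time-compactified `φ.boundaryExtension`-image of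
the generating curve `γ` of a Loewner chain with CONTINUOUS driving function `W`) whose range is
the range of a SIMPLE chord `c'` from `a` to `b` meeting `∂D` only at `a, b` is itself simple and
runs from `a` to `b`.

Proof.
* Endpoints: `κ 1 = b` by definition of the compactified image; `κ 0 = φ.bE (W 0)` is the image
  of a REAL point, hence a point of `∂D` (Carathéodory disc extension,
  `JordanDomain.exists_continuousOn_extension_holds`) lying on `range κ = range c'`, so it is `a`
  or `b`, and it is not `b` (`MarkedDomain.boundaryExtension_ne_pt_one`).
* Simplicity: with `j` an injective representative of `c'` the arc coordinate `f = j⁻¹ ∘ κ` is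
  continuous with `f 0 = 0`; if `f` were not strictly increasing, an argmax/intermediate-value
  argument (`mk_mem_simple_of_strictGrowth`, adapted from the kernel-checked tree lemma
  `simple_of_arc_range_of_strictGrowth` of `Cruxes/SimpleSubseqLimits/Lines/past-shadowing-costs-halves.lean`)
  produces `s < t` with `κ[s, t] ⊆ κ[0, s]`.  For `t = 1` this puts `b` on `φ.bE (γ[0, ∞))`,
  impossible; for `t < 1`, pulling back by the boundary extension (injective on the closed
  half-plane, `JordanDomain.injOn_boundaryExtension`) gives `γ[0, T] = γ[0, S]` for the capacity
  times `S = s/(1-s) < T = t/(1-t)`, hence EQUAL HULLS `K_T = K_S` (`IsGeneratedByCurve.hull_eq`),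
  contradicting the strict growth of Loewner hulls `K_S ⊂ K_T` (`Loewner.hull_ssubset_hull`,
  Lawler (2005), Thm. 4.6: `hcap K_t = 2t`).  This is Kemppainen–Smirnov's remark "for any
  parametrisation the capacity is strictly increasing" (arXiv:1212.6215, Thm. 1.3; Ann. Probab.
  45 (2017), Thm. 1.5) run backwards: a backtrack or a pause along an arc is a capacity plateau.

No measure theory and no lattice enter; the hypothesis `c'.range ⊆ closure D` is not needed.
-/

noncomputable section

open Filter Topology Set
open Literature.Probability.RandomPlanarGeometry
open UpperHalfPlane (upperHalfPlaneSet)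
open scoped NNReal unitInterval

namespace Summit.CriticalPhenomena.SAWScalingLimit.Theorems.SimpleSubseqLimits.CapacityClock.ArcClock

/-! ## The argmax lemma: arc range + strict range growth ⇒ simple -/

/-- **Argmax lemma** (adapted from the tree lemma `simple_of_arc_range_of_strictGrowth` of
`Cruxes/SimpleSubseqLimits/Lines/past-shadowing-costs-halves.lean`, ideator 3, kernel-checked
there): if the range of `γ` is the range of a SIMPLE curve `e` with the same starting point and
the range of `γ` STRICTLY GROWS on every nondegenerate parameter interval `[s, t]`
(`γ[s, t] ⊄ γ[0, s]`), then `γ` is injective, so its class is simple.  With the arc coordinate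
`f = e⁻¹ ∘ γ` (continuous: `e` is a homeomorphism onto its compact range), a failure of strict
monotonicity `f t₂ ≤ f t₁`, `t₁ < t₂`, yields a point `tₛ < t₂` dominating `f` on `[0, t₂]`
(argmax on the compact `[0, t₂]`), and then `f[tₛ, t₂] ⊆ [f 0, f tₛ] ⊆ f[0, tₛ]` by the
intermediate value theorem, i.e. `γ[tₛ, t₂] ⊆ γ[0, tₛ]`. [folklore] -/
theorem mk_mem_simple_of_strictGrowth (γ e : Curve ℂ) (he : e.IsSimple)
    (hrange : e.range = γ.range) (h0 : e 0 = γ 0)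
    (hgrow : ∀ s t : I, s < t → ¬ (γ '' Icc s t ⊆ γ '' Icc 0 s)) :
    CurveClass.mk γ ∈ CurveClass.simple := by
  classical
  -- adapted from `simple_of_arc_range_of_strictGrowth` (past-shadowing-costs-halves.lean §5)
  have he' : Function.Injective e := he
  have hmem : ∀ t, γ t ∈ Set.range e := fun t => by
    have h : γ t ∈ γ.range := ⟨t, rfl⟩
    rw [← hrange] at h
    exact h
  let E : I ≃ Set.range e := Equiv.ofInjective e he'
  have hEcont : Continuous E := continuous_induced_rng.2 e.continuous
  have hEsymm : Continuous E.symm := Continuous.continuous_symm_of_equiv_compact_to_t2 hEcont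
  let f : I → I := fun t => E.symm ⟨γ t, hmem t⟩
  have hγc : Continuous fun t : I => (⟨γ t, hmem t⟩ : Set.range e) :=
    continuous_induced_rng.2 γ.continuous
  have hf : Continuous f := hEsymm.comp hγc
  have hef : ∀ t, e (f t) = γ t := by
    intro t
    have h : ((E (f t) : Set.range e) : ℂ) = γ t := by
      show ((E (E.symm ⟨γ t, hmem t⟩) : Set.range e) : ℂ) = γ t
      rw [Equiv.apply_symm_apply]
    rw [← h]
    rfl
  have hf0 : f 0 = 0 := he' ((hef 0).trans h0.symm)
  -- real-valued copy of `f` and its extension to `ℝ` for the intermediate value theorem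
  let F : I → ℝ := fun t => (f t : ℝ)
  have hF : Continuous F := continuous_subtype_val.comp hf
  let FR : ℝ → ℝ := F ∘ Set.projIcc (0 : ℝ) 1 zero_le_one
  have hFR : Continuous FR := hF.comp continuous_projIcc
  -- the key step: a point `ts < t₂` dominating `f` on `[0, t₂]` contradicts strict growth
  have key : ∀ ts t₂ : I, ts < t₂ → (∀ t : I, t ≤ t₂ → F t ≤ F ts) → False := by
    intro ts t₂ hts hdom
    apply hgrow ts t₂ hts
    rintro _ ⟨t, ⟨hst, htt⟩, rfl⟩
    have hle : F t ≤ F ts := hdom t htt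
    have hge : F 0 ≤ F t := by
      show ((f 0 : I) : ℝ) ≤ (f t : ℝ)
      rw [hf0]; exact (f t).2.1
    -- IVT for `FR` on `[0, ts]`
    have hts0 : (0 : ℝ) ≤ (ts : ℝ) := ts.2.1
    have hIVT := intermediate_value_Icc hts0 hFR.continuousOn
    have hFR0 : FR 0 = F 0 := by
      show F (Set.projIcc 0 1 zero_le_one 0) = F 0
      rw [Set.projIcc_left]; rfl
    have hFRts : FR ts = F ts := by
      show F (Set.projIcc 0 1 zero_le_one (ts : ℝ)) = F ts
      rw [Set.projIcc_val]
    have hmemI : F t ∈ Set.Icc (FR 0) (FR ts) := by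
      rw [hFR0, hFRts]; exact ⟨hge, hle⟩
    obtain ⟨x, hx, hxval⟩ := hIVT hmemI
    have hx01 : x ∈ Set.Icc (0 : ℝ) 1 := ⟨hx.1, hx.2.trans ts.2.2⟩
    set s : I := Set.projIcc 0 1 zero_le_one x with hs
    have hsx : (s : ℝ) = x := by rw [hs, Set.projIcc_of_mem _ hx01]
    have hfs : f s = f t := by
      apply Subtype.ext
      show F s = F t
      have : FR x = F s := rfl
      rw [← this, hxval]
    refine ⟨s, ⟨bot_le, ?_⟩, ?_⟩
    · show (s : ℝ) ≤ (ts : ℝ)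
      rw [hsx]; exact hx.2
    · rw [← hef, hfs, hef]
  have hmono : StrictMono f := by
    intro t₁ t₂ hlt
    by_contra hnot
    have hle : f t₂ ≤ f t₁ := not_lt.1 hnot
    have hS : IsClosed {t : I | (t : ℝ) ≤ (t₂ : ℝ)} :=
      isClosed_le continuous_subtype_val continuous_const
    obtain ⟨tm, htm, hmax⟩ :=
      hS.isCompact.exists_isMaxOn ⟨t₂, show ((t₂ : I) : ℝ) ≤ t₂ from le_rfl⟩ hF.continuousOn
    have htm' : tm ≤ t₂ := htm
    by_cases hlt2 : tm < t₂
    · exact key tm t₂ hlt2 (fun t ht => hmax (show ((t : I) : ℝ) ≤ t₂ from ht))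
    · have htm2 : tm = t₂ := le_antisymm htm' (not_lt.1 hlt2)
      refine key t₁ t₂ hlt (fun t ht => ?_)
      have h1' : F t ≤ F tm := hmax (show ((t : I) : ℝ) ≤ t₂ from ht)
      have h2' : F t₂ ≤ F t₁ := by
        show ((f t₂ : I) : ℝ) ≤ (f t₁ : ℝ)
        exact_mod_cast hle
      calc F t ≤ F tm := h1'
        _ = F t₂ := by rw [htm2]
        _ ≤ F t₁ := h2'
  have hinj : Function.Injective γ := by
    intro a b hab
    apply hmono.injective
    apply he'
    rw [hef, hef]; exact hab
  exact CurveClass.mk_mem_simple hinj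

/-! ## The arc clock -/

/-- **The arc clock** (stub `stub_arcClock` of line `capacity-clock-no-plateau`, crux
`SimpleSubseqLimits`). A curve class `c` described by the Loewner evolution through a chordal
uniformizing map `φ` of `(D; a, b)` whose range is the range of a SIMPLE chord `c'` from `a` to
`b` meeting `∂D` only at `a, b` is itself simple and runs from `a` to `b`: the starting point
`φ.bE (W 0)` is a boundary point on the arc other than `b`, hence `a`; and a failure of
injectivity of the described representative `κ` forces, through the arc coordinate and the
argmax lemma `mk_mem_simple_of_strictGrowth`, a parameter interval on which `κ` stays inside its
own past, i.e. (pulling back by the injective boundary correspondence) two distinct capacity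
times with the same trace segment `γ[0, S] = γ[0, T]` and therefore the same Loewner hull —
contradicting the strict growth of hulls `Loewner.hull_ssubset_hull` (Lawler (2005), Thm. 4.6;
Kemppainen–Smirnov, Ann. Probab. 45 (2017), Thm. 1.5: "the capacity is strictly increasing").
[folklore] -/
theorem stub_arcClock (D : DobrushinDomain) (φ : ConformalEquiv upperHalfPlaneSet D.carrier)
    (hφ : D.IsChordalUniformizing φ) (c c' : CurveClass ℂ) (hc : IsLoewnerDescribable φ c)
    (hc' : c' ∈ CurveClass.simple) (h0 : c'.source = D.pt 0) (h1 : c'.target = D.pt 1)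
    (hcl : c'.range ⊆ closure D.carrier)
    (hfr : c'.range ∩ frontier D.carrier ⊆ {D.pt 0, D.pt 1}) (hrange : c.range = c'.range) :
    c ∈ CurveClass.simple ∧ c.source = D.pt 0 ∧ c.target = D.pt 1 := by
  have _hcl := hcl
  have _h1 := h1
  obtain ⟨W, hW, γ, hgen, κ, rfl, hκ⟩ := hc
  obtain ⟨j, hj, rfl⟩ := hc'
  rw [CurveClass.source_mk, Curve.source_def] at h0
  rw [CurveClass.range_mk, CurveClass.range_mk] at hrange
  rw [CurveClass.range_mk] at hfr
  have hC := JordanDomain.exists_continuousOn_extension_holds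
  -- the boundary extension omits `b` and is injective on the closed half-plane
  have hb : ∀ z : ℂ, 0 ≤ z.im → φ.boundaryExtension z ≠ D.pt 1 := fun z hz =>
    MarkedDomain.boundaryExtension_ne_pt_one hC hφ hz
  have hinj : InjOn φ.boundaryExtension {z : ℂ | 0 ≤ z.im} :=
    JordanDomain.injOn_boundaryExtension φ
  have hsub : ∀ t : ℝ≥0, γ '' Icc 0 t ⊆ {z : ℂ | 0 ≤ z.im} := by
    rintro t _ ⟨u, -, rfl⟩
    exact hgen.im_nonneg u
  have hκs : ∀ s : I, (s : ℝ) < 1 → κ s = φ.boundaryExtension (γ (rayParam s)) := hκ.1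
  have hκ1 : κ 1 = D.pt 1 := hκ.2
  have h01 : (((0 : I) : ℝ)) < 1 := by norm_num
  -- the starting point: a boundary point on the arc, other than `b`
  have hκ0fr : κ 0 ∈ frontier D.carrier := by
    rw [hκs 0 h01, rayParam_zero, hgen.apply_zero]
    obtain ⟨Ψ, hΨc, hΨeq, -, hsph⟩ := hC D.toJordanDomain (cayley.symm.trans φ)
    rw [JordanDomain.boundaryExtension_eq_of_extension φ hΨc hΨeq (by simp)]
    exact hsph.mapsTo (mem_sphere_zero_iff_norm.2 (norm_cayleyFun_ofReal (W 0)))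
  have hκ0 : κ 0 = D.pt 0 := by
    have hmem : κ 0 ∈ j.range ∩ frontier D.carrier := ⟨hrange ▸ (⟨0, rfl⟩ : κ 0 ∈ κ.range), hκ0fr⟩
    rcases hfr hmem with h | h
    · exact h
    · exact absurd ((hκs 0 h01).symm.trans h) (hb _ (hgen.im_nonneg _))
  refine ⟨?_, ?_, ?_⟩
  · -- simplicity, by the argmax lemma with the arc `j` and strict growth from the hulls
    refine mk_mem_simple_of_strictGrowth κ j hj hrange.symm (h0.trans hκ0.symm) ?_
    intro s t hst hst'
    have hs1 : (s : ℝ) < 1 := lt_of_lt_of_le (Subtype.coe_lt_coe.2 hst) t.2.2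
    by_cases ht1 : (t : ℝ) < 1
    · -- a plateau of the capacity clock between the times `rayParam s < rayParam t`
      have hIic : (κ : I → ℂ) '' Iic t ⊆ (κ : I → ℂ) '' Iic s := by
        rintro _ ⟨r, hr, rfl⟩
        rcases le_total r s with hrs | hsr
        · exact ⟨r, hrs, rfl⟩
        · obtain ⟨r', hr', hr'eq⟩ := hst' ⟨r, ⟨hsr, hr⟩, rfl⟩
          exact ⟨r', hr'.2, hr'eq⟩
      rw [hκ.image_Iic_eq hs1, hκ.image_Iic_eq ht1] at hIic
      have hγsub : γ '' Icc 0 (rayParam t) ⊆ γ '' Icc 0 (rayParam s) :=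
        (hinj.image_subset_image_iff (hsub _) (hsub _)).1 hIic
      have hle : rayParam s ≤ rayParam t := (rayParam_le_rayParam_iff hs1 ht1).2 hst.le
      have hlt : rayParam s < rayParam t := (rayParam_lt_rayParam_iff hs1 ht1).2 hst
      have hset : γ '' Icc 0 (rayParam t) = γ '' Icc 0 (rayParam s) :=
        hγsub.antisymm (image_mono (Icc_subset_Icc_right hle))
      have hK : Loewner.hull W (rayParam t) = Loewner.hull W (rayParam s) := by
        rw [hgen.hull_eq, hgen.hull_eq, hset]
      exact (Loewner.hull_ssubset_hull hW hlt).2 hK.subset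
    · -- `t = 1`: the target `b` would lie on `φ.bE (γ[0, ∞))`
      have ht : t = 1 := Subtype.ext (le_antisymm t.2.2 (not_lt.1 ht1))
      obtain ⟨r, hr, hreq⟩ := hst' ⟨t, ⟨hst.le, le_rfl⟩, rfl⟩
      have hr1 : (r : ℝ) < 1 := lt_of_le_of_lt (Subtype.coe_le_coe.2 hr.2) hs1
      refine hb _ (hgen.im_nonneg (rayParam r)) ?_
      rw [← hκs r hr1, hreq, ht]
      exact hκ1
  · -- source
    rw [CurveClass.source_mk, Curve.source_def]
    exact hκ0
  · -- target
    rw [CurveClass.target_mk, Curve.target_def]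
    exact hκ1

end Summit.CriticalPhenomena.SAWScalingLimit.Theorems.SimpleSubseqLimits.CapacityClock.ArcClock

end
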